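import Literature.NumberTheory.Sieve.HeathBrownMorozClassTypeIRegroup
import HarnessLib

/-!
# The head of the class Type-I estimate, II: the head `g ≤ Δ₀` in total (HB 2001 §5 p. 32)

Pure-proof file in the residue-class ("coset") port of D. R. Heath-Brown, *Primes represented by
`x³ + 2y³`*, Acta Math. 186 (2001), §5 pp. 30–32, to the class `x ≡ a, y ≡ b (mod d)` of
Heath-Brown–Moroz, Proc. LMS 88 (2004), §2.  Granted the class Lemma 5.1 in its proved shape
(`class_lemma_5_1_bound_of_lemma_4_7_bound`, file `HeathBrownMorozClassLemma51`: constants uniform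
in the class, range `X ≥ 2`, `d ≤ X`), the head term for one `g ≤ Δ` of the split class error
(`abs_classCountA_sub_mainTerm_le`) is bounded through the regrouping `class_sum_trBlock_head_le`
(file `HeathBrownMorozClassTypeIRegroup`) by `C₁ log(Q+2)^{c₁}(X/g + Q)τ(g)^{12(A+1)}` — zero when
`(g, d) ≠ 1` (`class_term_eq_zero_of_not_coprime`) — and then summed over `g ≤ Δ₀` with the
rational moments of `τ`, word for word as in `head_term_le` / `head_total_le` of
`HeathBrownCubicTypeIProofs` (p. 32: "the range `d ≤ Δ` contributes `≪ (X + QΔ)(log QX)^{c(A)}`").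
Content: `class_head_term_le` (one `g`; side conditions `2g ≤ X`, `dg ≤ X` from the class
Lemma 5.1), `class_head_total_le` (`g ≤ Δ₀`; `2Δ₀ ≤ X`, `dΔ₀ ≤ X`).  Constants are absolute
(uniform in the class). [cite: HeathBrownMoroz2004, Lemma 2.3] [cite: HeathBrownActa2001, §5 p. 32]
Search: `lean search 'head_term_le|head_total_le'` — only the `d = 1` versions.
-/

noncomputable section

open NumberField Finset Filter

open scoped Topology ArithmeticFunction.sigma

namespace Literature.NumberTheory.Sieve.CubicSieve

open LFunctions.CubeRootTwoField CubicPrimes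

/-! ### The head for one `g` -/

open scoped Classical in
/-- **The head for one `g`, class version** (p. 32): granted the class Lemma 5.1 in its proved
shape (constants `c₁, C₁ ≥ 0` uniform in the class; `X ≥ 2`, `d ≤ X`, `0 < η ≤ 1`, `Q > 0`), for
an admissible class and `g ≥ 1` with `2g ≤ X`, `dg ≤ X`,
`∑_{R∈𝒯r(Q)} τ(R)^A |S_g(R) − [(g,d)=1][(d,N R)=1] η²X²N((R,g))/(g²d²N(R))|
  ≤ C₁ log(Q+2)^{c₁}(X/g + Q)τ(g)^{12(A+1)}`
(zero for `(g,d) ≠ 1`; else `class_sum_trBlock_head_le`, the class Lemma 5.1 at `(X/g, Q/N(S))`,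
and `∑_{S∣(g)} τ(S)^A ≤ τ(g)^{12(A+1)}`).
[cite: HeathBrownMoroz2004, Lemma 2.3] [cite: HeathBrownActa2001, §5 p. 32] -/
theorem class_head_term_le {A : ℕ} {c₁ C₁ : ℝ} (hc₁ : 0 ≤ c₁) (hC₁ : 0 ≤ C₁) {d : ℕ}
    (h51 : ∀ a b : ℕ, a < d → b < d → Nat.Coprime (a ^ 3 + 2 * b ^ 3) d →
      ∀ X η Q : ℝ, 2 ≤ X → (d : ℝ) ≤ X → 0 < η → η ≤ 1 → 0 < Q →
      ∑ R ∈ (idealsLE ⌊2 * Q⌋₊).filter (fun R => Q < (Ideal.absNorm R : ℝ) ∧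
          (Ideal.absNorm R : ℝ) ≤ 2 * Q ∧ Squarefree (Ideal.absNorm R)),
        (idealDivisorCount R : ℝ) ^ A * |(classLatticeCount X η d a b R : ℝ) -
          (if Nat.Coprime d (Ideal.absNorm R) then η ^ 2 * X ^ 2 / ((d : ℝ) ^ 2 * Ideal.absNorm R)
            else 0)| ≤
      C₁ * (X + Q) * Real.log (Q + 2) ^ c₁)
    {X η Q : ℝ} {g a b : ℕ} (hd : 0 < d) (hadm : Nat.Coprime (a ^ 3 + 2 * b ^ 3) d) (hg : 0 < g)
    (h2gX : 2 * (g : ℝ) ≤ X) (hdgX : (d : ℝ) * g ≤ X) (hη0 : 0 < η) (hη1 : η ≤ 1) (hQ : 0 < Q) :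
    ∑ R ∈ (idealsLE ⌊2 * Q⌋₊).filter (fun R => Q < (Ideal.absNorm R : ℝ) ∧
        (Ideal.absNorm R : ℝ) ≤ 2 * Q ∧ Squarefree (Ideal.absNorm R)),
      (idealDivisorCount R : ℝ) ^ A *
        |(#{xy ∈ latticeBox (X / g) η | g * xy.1 ≡ a [MOD d] ∧ g * xy.2 ≡ b [MOD d] ∧
            R ∣ Ideal.span {(g : 𝓞 K)} * pairIdeal xy} : ℝ) -
          (if Nat.Coprime g d ∧ Nat.Coprime d (Ideal.absNorm R) then
            η ^ 2 * X ^ 2 * Ideal.absNorm (R ⊔ Ideal.span {(g : 𝓞 K)}) /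
              ((g : ℝ) ^ 2 * (d : ℝ) ^ 2 * Ideal.absNorm R) else 0)| ≤
    C₁ * Real.log (Q + 2) ^ c₁ * (X / g + Q) * (σ 0 g : ℝ) ^ (12 * (A + 1)) := by
  have hg' : (0 : ℝ) < g := by exact_mod_cast hg
  have hK : 0 ≤ C₁ * Real.log (Q + 2) ^ c₁ * (X / g + Q) := by
    have : 0 ≤ Real.log (Q + 2) ^ c₁ := Real.rpow_nonneg (Real.log_nonneg (by linarith)) _
    have : 0 ≤ X / g := div_nonneg (by linarith) hg'.le
    positivity
  by_cases hgd : Nat.Coprime g d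
  swap
  · refine le_trans (le_of_eq (sum_eq_zero fun R _ => ?_)) (by positivity)
    rw [class_term_eq_zero_of_not_coprime hadm hgd R, if_neg fun h => hgd h.1]
    simp
  obtain ⟨a', b', ha', hb', hadm', ha, hb⟩ := exists_reduced_class_of_coprime hd hgd hadm
  have hXg2 : 2 ≤ X / g := by rw [le_div_iff₀ hg']; linarith
  have hXgd : (d : ℝ) ≤ X / g := by rw [le_div_iff₀ hg']; linarith
  refine (class_sum_trBlock_head_le X η hQ hg hgd ha hb A).trans ?_
  set Sg : Ideal (𝓞 K) := Ideal.span {(g : 𝓞 K)} with hSg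
  have hSg0 : Sg ≠ ⊥ := span_natCast_ne_bot hg
  -- the inner sums by the class Lemma 5.1
  have hinner : ∀ S ∈ (idealsLE (Ideal.absNorm Sg)).filter (· ∣ Sg),
      (idealDivisorCount S : ℝ) ^ A *
        ∑ T ∈ (idealsLE ⌊2 * (Q / Ideal.absNorm S)⌋₊).filter (fun T =>
            Q / Ideal.absNorm S < (Ideal.absNorm T : ℝ) ∧
              (Ideal.absNorm T : ℝ) ≤ 2 * (Q / Ideal.absNorm S) ∧ Squarefree (Ideal.absNorm T)),
          (idealDivisorCount T : ℝ) ^ A *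
            |(classLatticeCount (X / g) η d a' b' T : ℝ) -
              (if Nat.Coprime d (Ideal.absNorm T) then
                η ^ 2 * (X / g) ^ 2 / ((d : ℝ) ^ 2 * Ideal.absNorm T) else 0)| ≤
      (idealDivisorCount S : ℝ) ^ A * (C₁ * Real.log (Q + 2) ^ c₁ * (X / g + Q)) := by
    intro S hS
    have hS0 : S ≠ ⊥ := by
      rintro rfl
      exact hSg0 (zero_dvd_iff.mp ((mem_filter_dvd_idealsLE_iff hSg0).mp hS))
    have hNS1 : (1 : ℝ) ≤ Ideal.absNorm S := by
      have : Ideal.absNorm S ≠ 0 := fun h => hS0 (Ideal.absNorm_eq_zero_iff.mp h)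
      exact_mod_cast Nat.one_le_iff_ne_zero.mpr this
    have hQS : 0 < Q / Ideal.absNorm S := div_pos hQ (by linarith)
    have hQS' : Q / Ideal.absNorm S ≤ Q := div_le_self hQ.le hNS1
    refine mul_le_mul_of_nonneg_left
      ((h51 a' b' ha' hb' hadm' (X / g) η (Q / Ideal.absNorm S) hXg2 hXgd hη0 hη1 hQS).trans ?_)
      (by positivity)
    have hlog : Real.log (Q / Ideal.absNorm S + 2) ^ c₁ ≤ Real.log (Q + 2) ^ c₁ :=
      Real.rpow_le_rpow (Real.log_nonneg (by linarith))
        (Real.log_le_log (by linarith) (by linarith)) hc₁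
    calc C₁ * (X / g + Q / Ideal.absNorm S) * Real.log (Q / Ideal.absNorm S + 2) ^ c₁
        ≤ C₁ * (X / g + Q) * Real.log (Q + 2) ^ c₁ := by
          refine mul_le_mul ?_ hlog (Real.rpow_nonneg (Real.log_nonneg (by linarith)) _)
            (by positivity)
          exact mul_le_mul_of_nonneg_left (by linarith) hC₁
      _ = C₁ * Real.log (Q + 2) ^ c₁ * (X / g + Q) := by ring
  refine (sum_le_sum hinner).trans ?_
  rw [← sum_mul]
  have hτ : ∑ S ∈ (idealsLE (Ideal.absNorm Sg)).filter (· ∣ Sg), (idealDivisorCount S : ℝ) ^ A ≤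
      (σ 0 g : ℝ) ^ (12 * (A + 1)) := by
    refine (sum_filter_dvd_pow_le _ hSg0 A).trans ?_
    rw [pow_mul]
    refine pow_le_pow_left₀ (Nat.cast_nonneg _) ?_ _
    exact_mod_cast idealDivisorCount_span_natCast_le hg
  calc (∑ S ∈ (idealsLE (Ideal.absNorm Sg)).filter (· ∣ Sg), (idealDivisorCount S : ℝ) ^ A) *
        (C₁ * Real.log (Q + 2) ^ c₁ * (X / g + Q))
      ≤ (σ 0 g : ℝ) ^ (12 * (A + 1)) * (C₁ * Real.log (Q + 2) ^ c₁ * (X / g + Q)) :=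
        mul_le_mul_of_nonneg_right hτ hK
    _ = _ := by ring

/-! ### The head summed over `g ≤ Δ₀` -/

open scoped Classical in
/-- **The head `g ≤ Δ₀` in total, class version** (p. 32:
"`≪ ∑_{d≤Δ}(X/d + Q)(log Q)^{c} ≪ (X + QΔ)(log QX)^{c}`"): granted the class Lemma 5.1 and the
rational moments of `τ^{12(A+1)}` (exponent `k`, constants `C₄, C₅`), for an admissible class,
`X ≥ 2`, `0 < η ≤ 1`, `Q ≥ 1`, `Δ₀ ≥ 1` with `2Δ₀ ≤ X`, `dΔ₀ ≤ X`, `log max(2,Δ₀) ≤ 3 log QX`,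
`QΔ₀ ≤ Q + XQ^{1/2}`:
`∑_{g≤Δ₀}(head for g) ≤ C₁2^{c₁}3^k(C₄ + 2C₅)(Q + XQ^{1/2} + X^{3/2})(log QX)^{c₁+k}`.
[cite: HeathBrownMoroz2004, Lemma 2.3] [cite: HeathBrownActa2001, §5 p. 32] -/
theorem class_head_total_le {A k : ℕ} {c₁ C₁ C₄ C₅ : ℝ} (hc₁ : 0 ≤ c₁) (hC₁ : 0 ≤ C₁)
    (hC₄ : 0 ≤ C₄) (hC₅ : 0 ≤ C₅) {d : ℕ}
    (h51 : ∀ a b : ℕ, a < d → b < d → Nat.Coprime (a ^ 3 + 2 * b ^ 3) d →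
      ∀ X η Q : ℝ, 2 ≤ X → (d : ℝ) ≤ X → 0 < η → η ≤ 1 → 0 < Q →
      ∑ R ∈ (idealsLE ⌊2 * Q⌋₊).filter (fun R => Q < (Ideal.absNorm R : ℝ) ∧
          (Ideal.absNorm R : ℝ) ≤ 2 * Q ∧ Squarefree (Ideal.absNorm R)),
        (idealDivisorCount R : ℝ) ^ A * |(classLatticeCount X η d a b R : ℝ) -
          (if Nat.Coprime d (Ideal.absNorm R) then η ^ 2 * X ^ 2 / ((d : ℝ) ^ 2 * Ideal.absNorm R)
            else 0)| ≤
      C₁ * (X + Q) * Real.log (Q + 2) ^ c₁)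
    (H4div : ∀ x : ℝ, 2 ≤ x → ∑ n ∈ Icc 1 ⌊x⌋₊, (σ 0 n : ℝ) ^ (12 * (A + 1)) / n ≤
      C₄ * Real.log x ^ k)
    (H4 : ∀ x : ℝ, 2 ≤ x → ∑ n ∈ Icc 1 ⌊x⌋₊, (σ 0 n : ℝ) ^ (12 * (A + 1)) ≤ C₅ * x * Real.log x ^ k)
    {a b : ℕ} (hd : 0 < d) (hadm : Nat.Coprime (a ^ 3 + 2 * b ^ 3) d)
    {X η Q : ℝ} (hX : 2 ≤ X) (hη0 : 0 < η) (hη1 : η ≤ 1) (hQ : 1 ≤ Q) {Δ₀ : ℕ} (hΔ₀ : 0 < Δ₀)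
    (h2Δ₀X : 2 * (Δ₀ : ℝ) ≤ X) (hdΔ₀X : (d : ℝ) * Δ₀ ≤ X)
    (hx₁ : Real.log (max 2 (Δ₀ : ℝ)) ≤ 3 * Real.log (Q * X))
    (hQΔ₀ : Q * Δ₀ ≤ Q + X * Real.sqrt Q) :
    ∑ g ∈ Icc 1 Δ₀, ∑ R ∈ (idealsLE ⌊2 * Q⌋₊).filter (fun R => Q < (Ideal.absNorm R : ℝ) ∧
        (Ideal.absNorm R : ℝ) ≤ 2 * Q ∧ Squarefree (Ideal.absNorm R)),
      (idealDivisorCount R : ℝ) ^ A *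
        |(#{xy ∈ latticeBox (X / g) η | g * xy.1 ≡ a [MOD d] ∧ g * xy.2 ≡ b [MOD d] ∧
            R ∣ Ideal.span {(g : 𝓞 K)} * pairIdeal xy} : ℝ) -
          (if Nat.Coprime g d ∧ Nat.Coprime d (Ideal.absNorm R) then
            η ^ 2 * X ^ 2 * Ideal.absNorm (R ⊔ Ideal.span {(g : 𝓞 K)}) /
              ((g : ℝ) ^ 2 * (d : ℝ) ^ 2 * Ideal.absNorm R) else 0)| ≤
    C₁ * 2 ^ c₁ * 3 ^ (k : ℝ) * (C₄ + 2 * C₅) *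
      (Q + X * Real.sqrt Q + X ^ (3 / 2 : ℝ)) * Real.log (Q * X) ^ (c₁ + k) := by
  set B : ℕ := 12 * (A + 1) with hB
  set L : ℝ := Real.log (Q * X) with hL
  set Lq : ℝ := Real.log (Q + 2) with hLq
  set x₁ : ℝ := max 2 (Δ₀ : ℝ) with hx₁def
  have hX0 : 0 < X := by linarith
  have hQ0 : 0 < Q := by linarith
  have hd' : (0 : ℝ) < d := by exact_mod_cast hd
  obtain ⟨hl2L, hlXL, -, hlQ2L, -, -, -⟩ := log_bounds hX hQ
  have hl2 : 0 < Real.log 2 := Real.log_pos one_lt_two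
  have hL0 : 0 < L := hl2.trans_le hl2L
  have hLq0 : 0 ≤ Lq := Real.log_nonneg (by linarith)
  have hx₁2 : 2 ≤ x₁ := le_max_left _ _
  have hlx₁0 : 0 ≤ Real.log x₁ := Real.log_nonneg (by linarith)
  have hΔ₀x₁ : Δ₀ ≤ ⌊x₁⌋₊ := Nat.le_floor (le_max_right _ _)
  -- each `g`
  have hterm : ∀ g ∈ Icc 1 Δ₀, ∑ R ∈ (idealsLE ⌊2 * Q⌋₊).filter (fun R =>
        Q < (Ideal.absNorm R : ℝ) ∧ (Ideal.absNorm R : ℝ) ≤ 2 * Q ∧ Squarefree (Ideal.absNorm R)),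
      (idealDivisorCount R : ℝ) ^ A *
        |(#{xy ∈ latticeBox (X / g) η | g * xy.1 ≡ a [MOD d] ∧ g * xy.2 ≡ b [MOD d] ∧
            R ∣ Ideal.span {(g : 𝓞 K)} * pairIdeal xy} : ℝ) -
          (if Nat.Coprime g d ∧ Nat.Coprime d (Ideal.absNorm R) then
            η ^ 2 * X ^ 2 * Ideal.absNorm (R ⊔ Ideal.span {(g : 𝓞 K)}) /
              ((g : ℝ) ^ 2 * (d : ℝ) ^ 2 * Ideal.absNorm R) else 0)| ≤
      C₁ * Lq ^ c₁ * (X * ((σ 0 g : ℝ) ^ B / g) + Q * (σ 0 g : ℝ) ^ B) := by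
    intro g hg
    rw [mem_Icc] at hg
    have hg0 : 0 < g := hg.1
    have hgΔ : (g : ℝ) ≤ Δ₀ := by exact_mod_cast hg.2
    have h2gX : 2 * (g : ℝ) ≤ X := le_trans (by linarith) h2Δ₀X
    have hdgX : (d : ℝ) * g ≤ X := le_trans (mul_le_mul_of_nonneg_left hgΔ hd'.le) hdΔ₀X
    refine (class_head_term_le hc₁ hC₁ h51 hd hadm hg0 h2gX hdgX hη0 hη1 hQ0).trans (le_of_eq ?_)
    rw [hB]
    ring
  refine (sum_le_sum hterm).trans ?_
  rw [← mul_sum, sum_add_distrib, ← mul_sum, ← mul_sum]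
  -- the rational moments over `g ≤ Δ₀ ≤ x₁`
  have hsub : Icc 1 Δ₀ ⊆ Icc 1 ⌊x₁⌋₊ := Icc_subset_Icc le_rfl hΔ₀x₁
  have hdiv : ∑ g ∈ Icc 1 Δ₀, (σ 0 g : ℝ) ^ B / g ≤ C₄ * Real.log x₁ ^ k :=
    (sum_le_sum_of_subset_of_nonneg hsub fun g _ _ => by positivity).trans (H4div x₁ hx₁2)
  have hmom : ∑ g ∈ Icc 1 Δ₀, (σ 0 g : ℝ) ^ B ≤ C₅ * x₁ * Real.log x₁ ^ k :=
    (sum_le_sum_of_subset_of_nonneg hsub fun g _ _ => by positivity).trans (H4 x₁ hx₁2)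
  -- logarithms and `x₁`
  have hlogx₁ : Real.log x₁ ^ k ≤ (3 * L) ^ k := pow_le_pow_left₀ hlx₁0 hx₁ k
  have hLq : Lq ^ c₁ ≤ (2 * L) ^ c₁ := Real.rpow_le_rpow hLq0 hlQ2L hc₁
  have hx₁Δ : x₁ ≤ 2 * Δ₀ := by
    have h1 : (1 : ℝ) ≤ Δ₀ := by exact_mod_cast hΔ₀
    exact max_le (by linarith) (by linarith)
  have hQx₁ : Q * x₁ ≤ 2 * (Q + X * Real.sqrt Q) := by
    calc Q * x₁ ≤ Q * (2 * Δ₀) := mul_le_mul_of_nonneg_left hx₁Δ hQ0.le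
      _ = 2 * (Q * Δ₀) := by ring
      _ ≤ 2 * (Q + X * Real.sqrt Q) := by linarith
  -- `P`
  set P : ℝ := Q + X * Real.sqrt Q + X ^ (3 / 2 : ℝ) with hP
  have hX32 : X ≤ X ^ (3 / 2 : ℝ) := by
    calc X = X ^ (1 : ℝ) := (Real.rpow_one X).symm
      _ ≤ X ^ (3 / 2 : ℝ) := Real.rpow_le_rpow_of_exponent_le (by linarith) (by norm_num)
  have hsq0 : 0 ≤ X * Real.sqrt Q := by positivity
  have hXP : X ≤ P := by rw [hP]; linarith
  have hQP : Q + X * Real.sqrt Q ≤ P := by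
    rw [hP]; linarith [Real.rpow_nonneg hX0.le (3 / 2 : ℝ)]
  have hP0 : 0 ≤ P := by linarith
  -- assemble
  have h3k : (3 * L) ^ k = 3 ^ (k : ℝ) * L ^ (k : ℝ) := by
    rw [mul_pow, ← Real.rpow_natCast, ← Real.rpow_natCast]
  have h2c : (2 * L) ^ c₁ = 2 ^ c₁ * L ^ c₁ := Real.mul_rpow zero_le_two hL0.le
  have hLck : L ^ c₁ * L ^ (k : ℝ) = L ^ (c₁ + k) := by rw [← Real.rpow_add hL0]
  calc C₁ * Lq ^ c₁ *
        (X * ∑ g ∈ Icc 1 Δ₀, (σ 0 g : ℝ) ^ B / g + Q * ∑ g ∈ Icc 1 Δ₀, (σ 0 g : ℝ) ^ B)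
      ≤ C₁ * (2 * L) ^ c₁ * (X * (C₄ * (3 * L) ^ k) + Q * (C₅ * x₁ * (3 * L) ^ k)) := by
        have h1 : X * ∑ g ∈ Icc 1 Δ₀, (σ 0 g : ℝ) ^ B / g ≤ X * (C₄ * (3 * L) ^ k) :=
          mul_le_mul_of_nonneg_left (hdiv.trans (mul_le_mul_of_nonneg_left hlogx₁ hC₄)) hX0.le
        have h2 : Q * ∑ g ∈ Icc 1 Δ₀, (σ 0 g : ℝ) ^ B ≤ Q * (C₅ * x₁ * (3 * L) ^ k) :=
          mul_le_mul_of_nonneg_left (hmom.trans (mul_le_mul_of_nonneg_left hlogx₁ (by positivity)))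
            hQ0.le
        have h0 : 0 ≤ X * (C₄ * (3 * L) ^ k) + Q * (C₅ * x₁ * (3 * L) ^ k) := by positivity
        calc C₁ * Lq ^ c₁ *
              (X * ∑ g ∈ Icc 1 Δ₀, (σ 0 g : ℝ) ^ B / g + Q * ∑ g ∈ Icc 1 Δ₀, (σ 0 g : ℝ) ^ B)
            ≤ C₁ * Lq ^ c₁ * (X * (C₄ * (3 * L) ^ k) + Q * (C₅ * x₁ * (3 * L) ^ k)) :=
              mul_le_mul_of_nonneg_left (add_le_add h1 h2) (by positivity)
          _ ≤ C₁ * (2 * L) ^ c₁ * (X * (C₄ * (3 * L) ^ k) + Q * (C₅ * x₁ * (3 * L) ^ k)) :=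
              mul_le_mul_of_nonneg_right (mul_le_mul_of_nonneg_left hLq hC₁) h0
    _ = C₁ * (2 * L) ^ c₁ * (3 * L) ^ k * (C₄ * X + C₅ * (Q * x₁)) := by ring
    _ ≤ C₁ * (2 * L) ^ c₁ * (3 * L) ^ k * (C₄ * P + C₅ * (2 * P)) := by
        refine mul_le_mul_of_nonneg_left (add_le_add (mul_le_mul_of_nonneg_left hXP hC₄)
          (mul_le_mul_of_nonneg_left (hQx₁.trans (by linarith)) hC₅)) (by positivity)
    _ = C₁ * 2 ^ c₁ * 3 ^ (k : ℝ) * (C₄ + 2 * C₅) * P * L ^ (c₁ + k) := by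
        rw [h2c, h3k, ← hLck]; ring

end Literature.NumberTheory.Sieve.CubicSieve

end
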